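import Mathlib
import HarnessLib
import Summits.MatrixMultiplication.MatrixMultiplication.Theorems.OutsiderSandwichBundledPrice

/-!
# OutsiderSandwich — «LASER BUNDLING NEVER SUBSIDISES MATRIX MULTIPLICATION»: the cut as a sandwich on
the bundled price, and the normal form of a counterexample to the residual
(decomp-mm lens 4 «minimal counterexample», gen 35, part 4/4)

Route `route-MatrixMultiplication-OutsiderSandwich`; cut of record UNCHANGED:
`closes (h₁ : LaserTangency) (h₂ : LaserMergeOptimal) (h₃ : SummitIffLaserTangency) : ω(ℂ) = 2`,
`LaserMergeOptimal` (stmt-27897) the declared residual; theorem-only, definition-free support.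

Notation of the sibling file `OutsiderSandwichBundledPrice`: `a = [⟨2,2,2⟩]`, `c = [cw₂]` in `T(ℂ)`,
`≲ = AsympLe (· ≤ ·)`, and a certificate `(p,q,n) ∈ ℕ³` is `(q + 27n)·a ≲ ⟨p⟩ ⊕ 4n·c³` («cert p q n»);
the bundled price `inf p/q = 2^{τ*} ∈ [4, 2^ω]` (`rpow_sSup_touching_eq_sInf` there).

§3 **THE CUT IS A SANDWICH ON ONE NUMBER** — both cruxes and the summit in one currency, with no
   `ω, ε, s, b, B, m, N` left in the attacked crux and no `ε, N, m` in the residual: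
   * `laserTangency_iff_certs`:  `LaserTangency ⟺ ∀ p q : ℕ, 4q < p → ∃ n, cert p q n`
     («bundled with enough laser extractions, an extra matrix product costs any price above `4` — as
     if `ω` were `2`»; price `= 4`);
   * `laserMergeOptimal_iff_noSubsidy`:  `LaserMergeOptimal ⟺ ∀ p q n, cert p q n → q·a ≲ ⟨p⟩`
     («LASER BUNDLING NEVER SUBSIDISES MATRIX MULTIPLICATION»: whatever extra products a laser bundle
     buys, the diagonal alone already buys; price `= 2^ω`);
   * `not_laserMergeOptimal_iff_subsidy` — THE LENS'S NORMAL FORM: a counterexample to the residual is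
     ONE TRIPLE `(p,q,n) ∈ ℕ³` with `cert p q n ∧ p < q·2^ω` (one asymptotic restriction in `T(ℂ)`);
   * `summit_iff_asympLe_four`: `ω = 2 ⟺ a ≲ ⟨4⟩`, and `summit_of_certs_of_noSubsidy` re-derives the
     deciding theorem in this currency (`q·2^ω ≤ 4q + 1` for every `q`);
   * `exists_cert_of_price_lt`: every rational above the price `2^{τ*}` is certified up to scaling.
§4 **NECESSARY CONDITIONS ON THE NORMAL FORM** (what a minimal counterexample must look like):
   `subsidy_pos` (`q ≥ 1`, `4q ≤ p < q·2^ω`; exhibiting one subsidy PROVES `ω > 2`: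
   `two_lt_omega_of_subsidy`), `subsidy_needs_bundle` (`n ≥ 1`), `subsidy_bundle_bound` (at every TOP
   universal point `q·2^ω − p ≤ n·(4F(cw₂)³ − 27·2^ω)`: the minimal criminal `F⋆` of g34, the top point
   of least laser excess, bounds the bundle size from below), and the CONDITIONAL INSTRUMENT READING
   `rpow_omega_le_of_cert`: under the residual every certificate is an upper bound `2^ω ≤ p/q`.
§5 **The linear (Farkas) form of the residual's negation** (critic g34 s1, tensor level):
   `not_laserMergeOptimal_iff_linear`: `¬LMO ⟺ ∃ n L : ℕ, ∀ universal F,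
   n·27F⟨2,2,2⟩ + L·F⟨2,2,2⟩ + 1 ≤ n·4F(cw₂)³ + L·2^ω` — ONE linear inequality valid on all of `X(T(ℂ))`
   (and `not_laserMergeOptimal_iff_linear_catalytic`: g34's catalytic family with catalyst EXACTLY `L·k`),
   with `L·(2^ω − 4) ≥ 1` forced at `ζ₁` (`linear_needs_catalyst`: the catalyst rate blows up as
   `ω → 2⁺`) and `n·(4F(cw₂)³ − 27·2^ω) ≥ 1` at top points (`linear_needs_bundle`).

Honest tags: support only; nothing here is a finite-level instrument (every statement is asymptotic;
by `laserMergeOptimal_iff_noSubsidy` a subsidy exists iff the residual fails, which forces `ω > 2`).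
References: [cite: Strassen1988, Thm. 2.3–2.4, Thm. 3.8]; [cite: Zuiddam2018, Thm. 2.12, Cor. 2.13,
Thm. 2.15]; [cite: CoppersmithWinograd1990, §6]; [cite: ChristandlVranaZuiddam2023, §1.2, Thm. 4.20].
-/

set_option linter.dupNamespace false

noncomputable section

namespace Summit.MatrixMultiplication.MatrixMultiplication.Theorems.OutsiderSandwichSubsidy

open Literature.Computability.AlgebraicComplexity
open Summit.MatrixMultiplication.MatrixMultiplication.Theses.OutsiderSandwich
open Summit.MatrixMultiplication.MatrixMultiplication.Theorems.OutsiderSandwichLaserFloor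
  (laserFloor two_le_matExp)
open Summit.MatrixMultiplication.MatrixMultiplication.Theorems.OutsiderSandwichBlock
  (map_matMulTensor_pos map_matMulTensor_le_four_of_matExp_le_two matExp_le_two_of_map_le_four)
open Summit.MatrixMultiplication.MatrixMultiplication.Theorems.OutsiderSandwichTouchingExponent
  (touchingExponents touchingExponents_subset_Icc bddAbove_touchingExponents
    laserTangency_iff_subset_two)
open Summit.MatrixMultiplication.MatrixMultiplication.Theorems.OutsiderSandwichTopFibreTensor
  (asympRankOf_mk_matMul laserFloor_cube laserFloor_asympLe xExp_le_floor_iff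
    laserMergeOptimal_iff_top_le not_laserMergeOptimal_iff_top_lt map_matMul_eq_iff_matExp_eq
    forall_top_iff_abstract)
open Summit.MatrixMultiplication.MatrixMultiplication.Theorems.OutsiderSandwichContactFace
  (gaugePoint₁_cwTensor_two gaugePoint₁_matMulTensor_two)
open Summit.MatrixMultiplication.MatrixMultiplication.Theorems.OutsiderSandwichFaceLocalisation
open Summit.MatrixMultiplication.MatrixMultiplication.Theorems.OutsiderSandwichFaceCertificates
open Summit.MatrixMultiplication.MatrixMultiplication.Theorems.OutsiderSandwichBundledPrice

variable {F : SpectralMap ℂ}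

/-! ## §3  The cut as a sandwich on the bundled price -/

/-- `LaserTangency ⟺` every tight universal point has `F⟨2,2,2⟩ ≤ 4` (`T ⊆ {2}` exponentiated).
[cite: Strassen1988, Thm. 2.3; CoppersmithWinograd1990, §6] -/
theorem laserTangency_iff_tight_le_four :
    LaserTangency ↔ ∀ F : SpectralMap ℂ, IsUniversalSpectralPoint ℂ F →
      27 * F (matMulTensor ℂ 2 2 2) = 4 * F (cwTensor ℂ 2) ^ 3 → F (matMulTensor ℂ 2 2 2) ≤ 4 := by
  rw [laserTangency_iff_subset_two]
  constructor
  · intro h F hF ht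
    have hmem : Real.logb 2 (F (matMulTensor ℂ 2 2 2)) ∈ touchingExponents :=
      ⟨F, hF, rfl, (tight_iff_touching hF).1 ht⟩
    exact map_matMulTensor_le_four_of_matExp_le_two hF (Set.mem_singleton_iff.1 (h hmem)).le
  · rintro h t ⟨F, hF, rfl, hx⟩
    have h4 := h F hF ((tight_iff_touching hF).2 hx)
    exact Set.mem_singleton_iff.2
      (le_antisymm (matExp_le_two_of_map_le_four hF h4) (two_le_matExp hF))

/-- **THE ATTACKED CRUX IN CERTIFICATE FORM (ω-, ε-, N-free):**
`LaserTangency ⟺ ∀ p q ∈ ℕ, 4q < p → ∃ n, (q + 27n)·[⟨2,2,2⟩] ≲ ⟨p⟩ ⊕ 4n·[cw₂]^{⊠3}`.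
[cite: Zuiddam2018, Thm. 2.12, Thm. 2.15; CoppersmithWinograd1990, §6; Strassen1988, Thm. 2.3] -/
theorem laserTangency_iff_certs :
    LaserTangency ↔ ∀ p q : ℕ, 4 * q < p → ∃ n : ℕ,
      AsympLe (fun x y : TensorClass ℂ => x ≤ y)
        ((q : TensorClass ℂ) * TensorClass.mk (matMulTensor ℂ 2 2 2) +
          (n : TensorClass ℂ) * (((27 : ℕ) : TensorClass ℂ) * TensorClass.mk (matMulTensor ℂ 2 2 2)))
        ((p : TensorClass ℂ) + (n : TensorClass ℂ) * (((4 : ℕ) : TensorClass ℂ) * TensorClass.mk (cwTensor ℂ 2) ^ 3)) := by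
  rw [laserTangency_iff_tight_le_four, forall_tight_iff_abstract (fun s _ => s ≤ 4)]
  have key := faceLe_nat_iff_certs (TensorClass.isStrassenPreorder ℂ)
    (((27 : ℕ) : TensorClass ℂ) * TensorClass.mk (matMulTensor ℂ 2 2 2))
    (((4 : ℕ) : TensorClass ℂ) * TensorClass.mk (cwTensor ℂ 2) ^ 3)
    (TensorClass.mk (matMulTensor ℂ 2 2 2)) 4 laserFloor_valid
  push_cast at key
  exact key

/-- `LaserMergeOptimal ⟺` some tight universal point is TOP (`F⟨2,2,2⟩ = 2^ω`).
[cite: CoppersmithWinograd1990, §6; Strassen1988, Thm. 3.8] -/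
theorem laserMergeOptimal_iff_exists_tight_top :
    LaserMergeOptimal ↔ ∃ F : SpectralMap ℂ, IsUniversalSpectralPoint ℂ F ∧
      27 * F (matMulTensor ℂ 2 2 2) = 4 * F (cwTensor ℂ 2) ^ 3 ∧
      F (matMulTensor ℂ 2 2 2) = (2 : ℝ) ^ omega ℂ := by
  rw [laserMergeOptimal_iff_top_le]
  refine exists_congr fun G => and_congr_right fun hG => ?_
  rw [map_matMul_eq_iff_matExp_eq hG]
  constructor
  · rintro ⟨hτ, hle⟩
    exact ⟨le_antisymm (laserFloor_cube hG) hle, hτ⟩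
  · rintro ⟨ht, hτ⟩
    exact ⟨hτ, ht.symm.le⟩

/-- **THE RESIDUAL, ω-FREE: «laser bundling never subsidises matrix multiplication».**
`LaserMergeOptimal ⟺ ∀ p q n, ((q + 27n)·a ≲ p + 4n·c³) → (q·a ≲ p)`.
[cite: Zuiddam2018, Thm. 2.12, Cor. 2.13, Thm. 2.15; CoppersmithWinograd1990, §6; Strassen1988, Thm. 3.8] -/
theorem laserMergeOptimal_iff_noSubsidy :
    LaserMergeOptimal ↔ ∀ p q n : ℕ,
      AsympLe (fun x y : TensorClass ℂ => x ≤ y)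
        ((q : TensorClass ℂ) * TensorClass.mk (matMulTensor ℂ 2 2 2) +
          (n : TensorClass ℂ) * (((27 : ℕ) : TensorClass ℂ) * TensorClass.mk (matMulTensor ℂ 2 2 2)))
        ((p : TensorClass ℂ) + (n : TensorClass ℂ) * (((4 : ℕ) : TensorClass ℂ) * TensorClass.mk (cwTensor ℂ 2) ^ 3)) →
      AsympLe (fun x y : TensorClass ℂ => x ≤ y)
        ((q : TensorClass ℂ) * TensorClass.mk (matMulTensor ℂ 2 2 2)) (p : TensorClass ℂ) := by
  rw [laserMergeOptimal_iff_exists_tight_top,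
    exists_tight_iff_abstract (fun s _ => s = (2 : ℝ) ^ omega ℂ), ← asympRankOf_mk_matMul]
  exact face_meets_top_iff_noSubsidy (TensorClass.isStrassenPreorder ℂ) laserFloor_valid
    face_nonempty one_le_mk_matMul

/-- **NORMAL FORM OF A COUNTEREXAMPLE TO THE RESIDUAL: one subsidised bundle.**
`¬ LaserMergeOptimal ⟺ ∃ p q n ∈ ℕ, p < q·2^ω ∧ (q + 27n)·[⟨2,2,2⟩] ≲ ⟨p⟩ ⊕ 4n·[cw₂]^{⊠3}`.
[cite: Zuiddam2018, Thm. 2.12, Cor. 2.13, Thm. 2.15; CoppersmithWinograd1990, §6; Strassen1988, Thm. 3.8] -/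
theorem not_laserMergeOptimal_iff_subsidy :
    ¬ LaserMergeOptimal ↔ ∃ p q n : ℕ, (p : ℝ) < q * (2 : ℝ) ^ omega ℂ ∧
      AsympLe (fun x y : TensorClass ℂ => x ≤ y)
        ((q : TensorClass ℂ) * TensorClass.mk (matMulTensor ℂ 2 2 2) +
          (n : TensorClass ℂ) * (((27 : ℕ) : TensorClass ℂ) * TensorClass.mk (matMulTensor ℂ 2 2 2)))
        ((p : TensorClass ℂ) + (n : TensorClass ℂ) * (((4 : ℕ) : TensorClass ℂ) * TensorClass.mk (cwTensor ℂ 2) ^ 3)) := by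
  rw [laserMergeOptimal_iff_noSubsidy]
  push Not
  refine exists_congr fun p => exists_congr fun q => exists_congr fun n => ?_
  rw [cert_unbundled_iff, not_le, and_comm]

/-- **The summit in the same currency**: `ω = 2 ⟺ [⟨2,2,2⟩] ≲ ⟨4⟩`. [cite: Strassen1988, Thm. 3.8] -/
theorem summit_iff_asympLe_four :
    _root_.MatrixMultiplication ↔
      AsympLe (fun x y : TensorClass ℂ => x ≤ y) (TensorClass.mk (matMulTensor ℂ 2 2 2))
        ((4 : ℕ) : TensorClass ℂ) := by
  have key := cert_unbundled_iff 4 1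
  rw [Nat.cast_one, one_mul, Nat.cast_one, one_mul] at key
  rw [key, _root_.MatrixMultiplication_iff]
  have h2 := omega_two_le ℂ
  constructor
  · intro h; rw [h]; norm_num
  · intro h
    have h4 : (2 : ℝ) ^ omega ℂ ≤ (2 : ℝ) ^ (2 : ℝ) := by rw [Real.rpow_two]; push_cast at h; linarith
    have := (Real.rpow_le_rpow_left_iff one_lt_two).1 h4
    linarith

/-- **The deciding theorem in price language**: certificates at every price above `4` (the attacked
crux) and no subsidy (the residual) give `q·2^ω ≤ 4q + 1` for every `q`, hence `ω = 2`.
[cite: Strassen1988, Thm. 3.8] -/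
theorem summit_of_certs_of_noSubsidy
    (h₁ : ∀ p q : ℕ, 4 * q < p → ∃ n : ℕ,
      AsympLe (fun x y : TensorClass ℂ => x ≤ y)
        ((q : TensorClass ℂ) * TensorClass.mk (matMulTensor ℂ 2 2 2) +
          (n : TensorClass ℂ) * (((27 : ℕ) : TensorClass ℂ) * TensorClass.mk (matMulTensor ℂ 2 2 2)))
        ((p : TensorClass ℂ) + (n : TensorClass ℂ) * (((4 : ℕ) : TensorClass ℂ) * TensorClass.mk (cwTensor ℂ 2) ^ 3)))
    (h₂ : ∀ p q n : ℕ,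
      AsympLe (fun x y : TensorClass ℂ => x ≤ y)
        ((q : TensorClass ℂ) * TensorClass.mk (matMulTensor ℂ 2 2 2) +
          (n : TensorClass ℂ) * (((27 : ℕ) : TensorClass ℂ) * TensorClass.mk (matMulTensor ℂ 2 2 2)))
        ((p : TensorClass ℂ) + (n : TensorClass ℂ) * (((4 : ℕ) : TensorClass ℂ) * TensorClass.mk (cwTensor ℂ 2) ^ 3)) →
      AsympLe (fun x y : TensorClass ℂ => x ≤ y)
        ((q : TensorClass ℂ) * TensorClass.mk (matMulTensor ℂ 2 2 2)) (p : TensorClass ℂ)) :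
    _root_.MatrixMultiplication := by
  rw [summit_iff_asympLe_four, ← one_mul (TensorClass.mk (matMulTensor ℂ 2 2 2)), ← Nat.cast_one,
    cert_unbundled_iff, Nat.cast_one, one_mul]
  refine le_of_forall_pos_lt_add fun ε hε => ?_
  obtain ⟨q, hq⟩ := exists_nat_gt (1 / ε)
  have hq0 : (0 : ℝ) < q := lt_trans (by positivity) hq
  obtain ⟨n, hc⟩ := h₁ (4 * q + 1) q (Nat.lt_succ_self _)
  have h3 := (cert_unbundled_iff _ _).1 (h₂ _ _ _ hc)
  push_cast at h3 ⊢
  have h4 : 1 < (q : ℝ) * ε := by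
    have := (div_lt_iff₀ hε).1 hq
    linarith
  by_contra hcon
  push Not at hcon
  have h5 : (q : ℝ) * (4 + ε) ≤ q * (2 : ℝ) ^ omega ℂ := mul_le_mul_of_nonneg_left hcon hq0.le
  linarith [mul_add (q : ℝ) 4 ε]

/-- **Every price above `2^{τ*}` is certified** (up to scaling): `2^{τ*}·q < p ⟹ ∃ k ≥ 1, n,
cert (k·p) (k·q) n` — with `isGLB_bundledPrice` this makes the certified ratios exactly the rationals
above the price (and the price itself iff the infimum is attained).
[cite: Zuiddam2018, Thm. 2.12, Thm. 2.15; Strassen1988, Thm. 2.3] -/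
theorem exists_cert_of_price_lt {p q : ℕ} (hlt : (2 : ℝ) ^ sSup touchingExponents * q < p) :
    ∃ k n : ℕ, 0 < k ∧
      AsympLe (fun x y : TensorClass ℂ => x ≤ y)
        (((k * q : ℕ) : TensorClass ℂ) * TensorClass.mk (matMulTensor ℂ 2 2 2) +
          (n : TensorClass ℂ) * (((27 : ℕ) : TensorClass ℂ) * TensorClass.mk (matMulTensor ℂ 2 2 2)))
        (((k * p : ℕ) : TensorClass ℂ) +
          (n : TensorClass ℂ) * (((4 : ℕ) : TensorClass ℂ) * TensorClass.mk (cwTensor ℂ 2) ^ 3)) := by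
  refine exists_pos_cert_of_faceLt (TensorClass.isStrassenPreorder ℂ) laserFloor_valid face_nonempty
    ((forall_tight_iff_abstract (fun s _ => (q : ℝ) * s < p)).1 fun F hF ht => ?_)
  have h1 := map_matMul_le_rpow_sSup_of_tight hF ht
  have hq : (0 : ℝ) ≤ q := Nat.cast_nonneg q
  nlinarith

/-! ## §4  Necessary conditions on the normal form `(p, q, n)` -/

/-- A subsidy has `q ≥ 1` and `4q ≤ p < q·2^ω`. [cite: Strassen1988, Thm. 3.8] -/
theorem subsidy_pos {p q n : ℕ} (hlt : (p : ℝ) < q * (2 : ℝ) ^ omega ℂ)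
    (hc : AsympLe (fun x y : TensorClass ℂ => x ≤ y)
      ((q : TensorClass ℂ) * TensorClass.mk (matMulTensor ℂ 2 2 2) +
        (n : TensorClass ℂ) * (((27 : ℕ) : TensorClass ℂ) * TensorClass.mk (matMulTensor ℂ 2 2 2)))
      ((p : TensorClass ℂ) + (n : TensorClass ℂ) * (((4 : ℕ) : TensorClass ℂ) * TensorClass.mk (cwTensor ℂ 2) ^ 3))) :
    0 < q ∧ 4 * q ≤ p := by
  refine ⟨Nat.pos_of_ne_zero ?_, four_mul_le_of_cert hc⟩
  rintro rfl
  simp only [Nat.cast_zero, zero_mul] at hlt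
  exact absurd hlt (not_lt.2 (Nat.cast_nonneg p))

/-- **Exhibiting one subsidised bundle proves `ω > 2`.** [cite: Strassen1988, Thm. 3.8] -/
theorem two_lt_omega_of_subsidy {p q n : ℕ} (hlt : (p : ℝ) < q * (2 : ℝ) ^ omega ℂ)
    (hc : AsympLe (fun x y : TensorClass ℂ => x ≤ y)
      ((q : TensorClass ℂ) * TensorClass.mk (matMulTensor ℂ 2 2 2) +
        (n : TensorClass ℂ) * (((27 : ℕ) : TensorClass ℂ) * TensorClass.mk (matMulTensor ℂ 2 2 2)))
      ((p : TensorClass ℂ) + (n : TensorClass ℂ) * (((4 : ℕ) : TensorClass ℂ) * TensorClass.mk (cwTensor ℂ 2) ^ 3))) :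
    2 < omega ℂ := by
  obtain ⟨hq, h4⟩ := subsidy_pos hlt hc
  have hq' : (0 : ℝ) < q := by exact_mod_cast hq
  have h4' : (4 : ℝ) * q ≤ p := by exact_mod_cast h4
  have hlt4 : (2 : ℝ) ^ (2 : ℝ) < (2 : ℝ) ^ omega ℂ := by
    rw [Real.rpow_two]
    by_contra hcon
    push Not at hcon
    nlinarith
  exact (Real.rpow_lt_rpow_left_iff one_lt_two).1 hlt4

/-- **A subsidy needs laser bundling**: `n ≥ 1` (at `n = 0` the price is `2^ω`).
[cite: Strassen1988, Thm. 3.8; Zuiddam2018, Cor. 2.13] -/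
theorem subsidy_needs_bundle {p q n : ℕ} (hlt : (p : ℝ) < q * (2 : ℝ) ^ omega ℂ)
    (hc : AsympLe (fun x y : TensorClass ℂ => x ≤ y)
      ((q : TensorClass ℂ) * TensorClass.mk (matMulTensor ℂ 2 2 2) +
        (n : TensorClass ℂ) * (((27 : ℕ) : TensorClass ℂ) * TensorClass.mk (matMulTensor ℂ 2 2 2)))
      ((p : TensorClass ℂ) + (n : TensorClass ℂ) * (((4 : ℕ) : TensorClass ℂ) * TensorClass.mk (cwTensor ℂ 2) ^ 3))) :
    1 ≤ n := by
  refine Nat.one_le_iff_ne_zero.2 ?_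
  rintro rfl
  simp only [Nat.cast_zero, zero_mul, add_zero] at hc
  exact (not_le.2 hlt) ((cert_unbundled_iff p q).1 hc)

/-- **Bundle-size bound at the top fibre**: at every top universal point,
`q·2^ω − p ≤ n·(4F(cw₂)³ − 27·2^ω)`; with g34's minimal criminal (least laser excess) this bounds `n`
from below. [cite: Zuiddam2018, Thm. 2.12; Strassen1988, Thm. 3.8] -/
theorem subsidy_bundle_bound {p q n : ℕ}
    (hc : AsympLe (fun x y : TensorClass ℂ => x ≤ y)
      ((q : TensorClass ℂ) * TensorClass.mk (matMulTensor ℂ 2 2 2) +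
        (n : TensorClass ℂ) * (((27 : ℕ) : TensorClass ℂ) * TensorClass.mk (matMulTensor ℂ 2 2 2)))
      ((p : TensorClass ℂ) + (n : TensorClass ℂ) * (((4 : ℕ) : TensorClass ℂ) * TensorClass.mk (cwTensor ℂ 2) ^ 3)))
    (hF : IsUniversalSpectralPoint ℂ F) (hτ : Real.logb 2 (F (matMulTensor ℂ 2 2 2)) = omega ℂ) :
    (q : ℝ) * (2 : ℝ) ^ omega ℂ - p ≤ n * (4 * F (cwTensor ℂ 2) ^ 3 - 27 * (2 : ℝ) ^ omega ℂ) := by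
  have hφ := TensorClass.isSpectralPoint_eval hF
  have h1 := ((TensorClass.isStrassenPreorder ℂ).asympLe_iff_forall_spectralPoint.1 hc) _ hφ
  simp only [hφ.map_add, hφ.map_mul, hφ.map_natCast, hφ.map_pow, TensorClass.eval_mk hF] at h1
  push_cast at h1
  rw [(map_matMul_eq_iff_matExp_eq hF).2 hτ] at h1
  linarith

/-- **Conditional instrument reading**: UNDER the residual, every certificate is an upper bound on
`ω`: `2^ω ≤ p/q`. [cite: Zuiddam2018, Thm. 2.12, Cor. 2.13; Strassen1988, Thm. 3.8] -/
theorem rpow_omega_le_of_cert (hL : LaserMergeOptimal) {p q n : ℕ} (hq : 0 < q)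
    (hc : AsympLe (fun x y : TensorClass ℂ => x ≤ y)
      ((q : TensorClass ℂ) * TensorClass.mk (matMulTensor ℂ 2 2 2) +
        (n : TensorClass ℂ) * (((27 : ℕ) : TensorClass ℂ) * TensorClass.mk (matMulTensor ℂ 2 2 2)))
      ((p : TensorClass ℂ) + (n : TensorClass ℂ) * (((4 : ℕ) : TensorClass ℂ) * TensorClass.mk (cwTensor ℂ 2) ^ 3))) :
    (2 : ℝ) ^ omega ℂ ≤ p / q := by
  have h1 := (cert_unbundled_iff p q).1 (laserMergeOptimal_iff_noSubsidy.1 hL p q n hc)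
  rw [le_div_iff₀ (by exact_mod_cast hq : (0 : ℝ) < q)]
  linarith [mul_comm (q : ℝ) ((2 : ℝ) ^ omega ℂ)]

/-! ## §5  The linear (Farkas) form of `¬ LaserMergeOptimal` -/

/-- Bridge without side condition. [cite: ChristandlVranaZuiddam2023, §1.2] -/
theorem forall_univ_iff_abstract (R : ℝ → ℝ → Prop) :
    (∀ F : SpectralMap ℂ, IsUniversalSpectralPoint ℂ F → R (F (matMulTensor ℂ 2 2 2)) (F (cwTensor ℂ 2))) ↔
    (∀ φ : TensorClass ℂ → ℝ, IsSpectralPoint (fun x y : TensorClass ℂ => x ≤ y) φ →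
        R (φ (TensorClass.mk (matMulTensor ℂ 2 2 2))) (φ (TensorClass.mk (cwTensor ℂ 2)))) := by
  constructor
  · intro H φ hφ
    have h1 := H _ (TensorClass.isUniversalSpectralPoint_spectralMapOf hφ)
    rwa [TensorClass.spectralMapOf_apply, TensorClass.spectralMapOf_apply] at h1
  · intro H F hF
    have h1 := H _ (TensorClass.isSpectralPoint_eval hF)
    rwa [TensorClass.eval_mk hF, TensorClass.eval_mk hF] at h1

/-- `¬ LaserMergeOptimal` as a strict inequality on the top fibre of `X(T(ℂ))` over `a = [⟨2,2,2⟩]`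
between `u = 27a` and `v = 4c³`. [cite: CoppersmithWinograd1990, §6; Strassen1988, Thm. 3.8] -/
theorem not_laserMergeOptimal_iff_abstract :
    ¬ LaserMergeOptimal ↔ ∀ φ : TensorClass ℂ → ℝ, IsSpectralPoint (fun x y : TensorClass ℂ => x ≤ y) φ →
      φ (TensorClass.mk (matMulTensor ℂ 2 2 2)) =
        asympRankOf (fun x y : TensorClass ℂ => x ≤ y) (TensorClass.mk (matMulTensor ℂ 2 2 2)) →
      φ (((27 : ℕ) : TensorClass ℂ) * TensorClass.mk (matMulTensor ℂ 2 2 2)) <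
        φ (((4 : ℕ) : TensorClass ℂ) * TensorClass.mk (cwTensor ℂ 2) ^ 3) := by
  rw [not_laserMergeOptimal_iff_top_lt,
    forall_top_iff_abstract (matMulTensor ℂ 2 2 2) (cwTensor ℂ 2) (fun s t => 27 * s < 4 * t ^ 3)]
  refine forall_congr' fun φ => forall_congr' fun hφ => ?_
  rw [hφ.map_mul, hφ.map_mul, hφ.map_natCast, hφ.map_natCast, hφ.map_pow]
  push_cast
  exact Iff.rfl

/-- **THE LINEAR FORM** (open-condition / Farkas certificate of the residual's negation):
`¬ LaserMergeOptimal ⟺ ∃ n L : ℕ, ∀ universal F, n·27F⟨2,2,2⟩ + L·F⟨2,2,2⟩ + 1 ≤ n·4F(cw₂)³ + L·2^ω`.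
[cite: Zuiddam2018, Thm. 2.12, Thm. 2.15; Strassen1988, Thm. 2.4, Thm. 3.8; CoppersmithWinograd1990, §6] -/
theorem not_laserMergeOptimal_iff_linear :
    ¬ LaserMergeOptimal ↔ ∃ n L : ℕ, ∀ F : SpectralMap ℂ, IsUniversalSpectralPoint ℂ F →
      (n : ℝ) * (27 * F (matMulTensor ℂ 2 2 2)) + L * F (matMulTensor ℂ 2 2 2) + 1 ≤
        n * (4 * F (cwTensor ℂ 2) ^ 3) + L * (2 : ℝ) ^ omega ℂ := by
  rw [not_laserMergeOptimal_iff_abstract, topLt_iff_linear (TensorClass.isStrassenPreorder ℂ),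
    asympRankOf_mk_matMul]
  refine exists_congr fun n => exists_congr fun L => ?_
  rw [forall_univ_iff_abstract (fun s t => (n : ℝ) * (27 * s) + L * s + 1 ≤
    n * (4 * t ^ 3) + L * (2 : ℝ) ^ omega ℂ)]
  refine forall_congr' fun φ => forall_congr' fun hφ => ?_
  rw [hφ.map_mul, hφ.map_mul, hφ.map_natCast, hφ.map_natCast, hφ.map_pow]
  push_cast
  exact Iff.rfl

/-- **THE CATALYTIC FAMILY WITH A LINEAR CATALYST** (critic g34 s1 typed: `l = L·k`):
`¬ LaserMergeOptimal ⟺ ∃ n L, ∀ k, ∃ r ≤ L·k·2^ω + 2,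
 k·(n·27[⟨2,2,2⟩] ⊕ 1) ⊕ (L·k)·[⟨2,2,2⟩] ≲ k·n·4[cw₂]^{⊠3} ⊕ ⟨r⟩` — `k` bundles each earn one extra unit,
borrowing `L` matrix products per bundle as a CATALYST repaid in diagonal at the full price `2^ω`.
[cite: Zuiddam2018, Thm. 2.12, Thm. 2.15; Strassen1988, Thm. 2.4, Thm. 3.8; CoppersmithWinograd1990, §6] -/
theorem not_laserMergeOptimal_iff_linear_catalytic :
    ¬ LaserMergeOptimal ↔ ∃ n L : ℕ, ∀ k : ℕ, ∃ r : ℕ, (r : ℝ) ≤ L * k * (2 : ℝ) ^ omega ℂ + 2 ∧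
      AsympLe (fun x y : TensorClass ℂ => x ≤ y)
        ((k : TensorClass ℂ) * ((n : TensorClass ℂ) *
            (((27 : ℕ) : TensorClass ℂ) * TensorClass.mk (matMulTensor ℂ 2 2 2)) + 1) +
          ((L * k : ℕ) : TensorClass ℂ) * TensorClass.mk (matMulTensor ℂ 2 2 2))
        ((k : TensorClass ℂ) * ((n : TensorClass ℂ) *
            (((4 : ℕ) : TensorClass ℂ) * TensorClass.mk (cwTensor ℂ 2) ^ 3)) + (r : TensorClass ℂ)) := by
  rw [not_laserMergeOptimal_iff_abstract,
    topLt_iff_linear_catalytic (TensorClass.isStrassenPreorder ℂ), asympRankOf_mk_matMul]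

/-- **The catalyst is forced** (evaluate at `ζ₁`): `L·(2^ω − 4) ≥ 1`. [cite: Strassen1988, Thm. 3.8] -/
theorem linear_needs_catalyst {n L : ℕ}
    (h : ∀ F : SpectralMap ℂ, IsUniversalSpectralPoint ℂ F →
      (n : ℝ) * (27 * F (matMulTensor ℂ 2 2 2)) + L * F (matMulTensor ℂ 2 2 2) + 1 ≤
        n * (4 * F (cwTensor ℂ 2) ^ 3) + L * (2 : ℝ) ^ omega ℂ) :
    1 ≤ (L : ℝ) * ((2 : ℝ) ^ omega ℂ - 4) := by
  have h1 := h _ (gaugePoint₁_isUniversalSpectralPoint ℂ)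
  rw [gaugePoint₁_matMulTensor_two, gaugePoint₁_cwTensor_two] at h1
  linarith

/-- **The bundle is forced** (evaluate at a top point): `n·(4F(cw₂)³ − 27·2^ω) ≥ 1`.
[cite: Strassen1988, Thm. 2.4, Thm. 3.8] -/
theorem linear_needs_bundle {n L : ℕ}
    (h : ∀ F : SpectralMap ℂ, IsUniversalSpectralPoint ℂ F →
      (n : ℝ) * (27 * F (matMulTensor ℂ 2 2 2)) + L * F (matMulTensor ℂ 2 2 2) + 1 ≤
        n * (4 * F (cwTensor ℂ 2) ^ 3) + L * (2 : ℝ) ^ omega ℂ)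
    (hF : IsUniversalSpectralPoint ℂ F) (hτ : Real.logb 2 (F (matMulTensor ℂ 2 2 2)) = omega ℂ) :
    1 ≤ (n : ℝ) * (4 * F (cwTensor ℂ 2) ^ 3 - 27 * (2 : ℝ) ^ omega ℂ) := by
  have h1 := h F hF
  rw [(map_matMul_eq_iff_matExp_eq hF).2 hτ] at h1
  linarith

end Summit.MatrixMultiplication.MatrixMultiplication.Theorems.OutsiderSandwichSubsidy

end
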